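import Literature.Computability.Cryptography.GoldreichLevinInverter
import HarnessLib

/-!
# The Goldreich–Levin theorem for hiding functions: the contradiction with hiding (final assembly)

Crypto layer, part 4, on top of `GoldreichLevinInverter.lean` (the inverter `𝒜_GL = GLInv.alg` and
its success probability `GLInv.hidingProb_ge`). This file supplies the asymptotic half of the
printed proof (Goldreich 2001, Thm 2.5.6 with §2.5.2; Liu–Pass 2020, Appendix, Thm [GL89]):

* the **coin budget** `GLFin.cl` of `𝒜_GL` (the coin-length trick of `YaoAmplification.lean`): `D`'s
  coin count `κ_D(n)` on the samples of level `n` is not computable from `n`, so the budget hands the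
  program `C(n) = K_b(n)·base(n) + κ_D(n)` coins — `≡ κ_D(n) (mod K_b(n))`, as `GLInv.run` decodes it
  — on the input lengths `2n + 2 + ℓ_g(n)` of a sparse increasing sequence of good levels
  (`Yao.seqN`, `Yao.sel`), and is polynomially bounded (`cl_le`);
* the choice of the number of seeds, `e = c + d` (`n_le`: `n ≤ 2(δ/2^{K+1})²(2^k − 1)` for
  `δ = 1/n^c`), and the clean bound `hidingProb ≥ 1/(2^{2e+4}·n^{c+d+2e+1})` at the good levels;
* **`goldreichLevin_hiding_len_of_polyTime : GLInv.glInvRun_polyTime → goldreichLevin_hiding_len`**: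
  a PPT distinguisher with non-negligible advantage (`≥ 1/n^c` infinitely often,
  `exists_frequently_ge`) makes `𝒜_GL` recover `x ← S_n` with probability `≥ 1/poly(n)` infinitely
  often, contradicting `IsHidingOver` (`isNegligible_iff_eventually_lt_of_nonneg`).

With the efficiency fact `GLInv.glInvRun_polyTime` discharged (the `FP` pipeline of the sequel),
this yields `goldreichLevin_hiding_len`, hence Liu–Pass's Thm 5.5 and Thm 1.1
(`LiuPassLemma53Assembly.lean`).

## References

* O. Goldreich, L. A. Levin, *A hard-core predicate for all one-way functions*, STOC 1989, 25–32.
* O. Goldreich, *Foundations of Cryptography I*, CUP 2001, §1.3.5 (negligible functions), §2.5.2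
  (the sign of the gap, Markov over the instances), Thm 2.5.6 (proof, §2.5.3).
* Y. Liu, R. Pass, *On one-way functions and Kolmogorov complexity*, FOCS 2020 (arXiv:2009.11514),
  Appendix, Thm [GL89].
-/

namespace Literature.Computability.Cryptography

open Finset Filter Asymptotics _root_.Computability Complexity GLInv

namespace GLFin

/-! ### The coin count of the inverter at a level -/

section Budget

variable (D : RandAlg (List Bool) Bool) (qD : Polynomial ℕ) (d c : ℕ) (ℓg : ℕ → ℕ)

/-- The input length `|⟨1ⁿ, g(x‖ρ)⟩| = 2n + 2 + ℓ_g(n)` of the inverter at level `n`. [folklore] -/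
def L (n : ℕ) : ℕ := 2 * n + 2 + ℓg n

/-- All coin fields of `𝒜_GL` except `D`'s coins and the padding:
`1 + K + 1 + Kn + K + kn + k` (`k = kof (c + d) n`). [folklore] -/
def base (n : ℕ) : ℕ := 1 + Kof d n + 1 + Kof d n * n + Kof d n + kof (c + d) n * n + kof (c + d) n

/-- `D`'s coin count `κ_D(n)` on the samples of level `n`. [folklore] -/
def κD (n : ℕ) : ℕ := D.coinLen (Lin d n (ℓg n))

/-- The padding `W(n) = (K_b(n) − 1)·base(n)`, making the total `≡ κ_D(n) (mod K_b(n))`. [folklore] -/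
def W (n : ℕ) : ℕ := (Kb qD d n (ℓg n) - 1) * base d c n

/-- **The coin count `C(n)`** in the nesting of `GLInv.hidingProb_ge`. [folklore] -/
def Ctot (n : ℕ) : ℕ :=
  1 + (Kof d n + (1 + (Kof d n * n + (Kof d n + (κD D d ℓg n + (kof (c + d) n * n + (kof (c + d) n + W qD d c ℓg n)))))))

/-- `C(n) = K_b(n)·base(n) + κ_D(n)`. [folklore] -/
theorem Ctot_eq (n : ℕ) : Ctot D qD d c ℓg n = Kb qD d n (ℓg n) * base d c n + κD D d ℓg n := by
  have hKb : 1 ≤ Kb qD d n (ℓg n) := by unfold Kb; omega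
  unfold Ctot W
  have : (Kb qD d n (ℓg n) - 1) * base d c n + base d c n = Kb qD d n (ℓg n) * base d c n := by
    conv_rhs => rw [← Nat.sub_add_cancel hKb]
    ring
  unfold base at this ⊢
  omega

/-- **The budget decodes to `κ_D(n)`**: `C(n) mod K_b(n) = κ_D(n)` when `coinLen_D ≤ q_D`. [folklore] -/
theorem Ctot_mod (hqD : ∀ ℓ, D.coinLen ℓ ≤ qD.eval ℓ) (n : ℕ) : Ctot D qD d c ℓg n % Kb qD d n (ℓg n) = κD D d ℓg n := by
  rw [Ctot_eq, Nat.mul_add_mod]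
  apply Nat.mod_eq_of_lt
  unfold κD Kb
  exact Nat.lt_succ_of_le (hqD _)

/-- **The coin budget of `𝒜_GL`**: `C(n)` coins on the input length of a selected good level `n`
(`Yao.sel` with spread `L`), `0` elsewhere. [folklore] -/
noncomputable def cl (G : ℕ → Prop) (ℓ : ℕ) : ℕ :=
  if L ℓg (Yao.sel G (L ℓg) ℓ) = ℓ then Ctot D qD d c ℓg (Yao.sel G (L ℓg) ℓ) else 0

variable {D qD d c ℓg}

/-- Levels lie below their input lengths. [folklore] -/
theorem le_L (n : ℕ) : n ≤ L ℓg n := by unfold L; omega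

/-- On the input length of the `j`-th selected level the budget is `C`. [folklore] -/
theorem cl_apply_L {G : ℕ → Prop} (hG : ∀ a, ∃ b, a ≤ b ∧ G b) (j : ℕ) :
    cl D qD d c ℓg G (L ℓg (Yao.seqN G (L ℓg) j)) = Ctot D qD d c ℓg (Yao.seqN G (L ℓg) j) := by
  have hsel : Yao.sel G (L ℓg) (L ℓg (Yao.seqN G (L ℓg) j)) = Yao.seqN G (L ℓg) j := Yao.sel_eq hG le_L (le_L _) le_rfl
  unfold cl
  rw [hsel, if_pos rfl]

/-- A polynomial bound on `base`. [folklore] -/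
noncomputable def basePoly (d c : ℕ) : Polynomial ℕ :=
  2 + 2 * Polynomial.C d * Polynomial.X + Polynomial.C d * Polynomial.X * Polynomial.X +
    (Polynomial.C (2 * (c + d) + 1) * (Polynomial.X + 1) + 1) * (Polynomial.X + 1)

/-- `base n ≤ basePoly n`. [folklore] -/
theorem base_le (n : ℕ) : base d c n ≤ (basePoly d c).eval n := by
  have hK : Kof d n ≤ d * n := Nat.mul_le_mul_left d (Nat.log_le_self 2 n)
  have hk : kof (c + d) n ≤ (2 * (c + d) + 1) * (n + 1) + 1 := by
    unfold kof
    have := Nat.log_le_self 2 n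
    exact Nat.succ_le_succ (Nat.mul_le_mul_left _ (by omega))
  have heval : (basePoly d c).eval n = 2 + 2 * (d * n) + (d * n) * n + ((2 * (c + d) + 1) * (n + 1) + 1) * (n + 1) := by
    simp [basePoly]; ring
  rw [heval]
  unfold base
  have h1 : Kof d n * n ≤ (d * n) * n := Nat.mul_le_mul_right _ hK
  have h2 : kof (c + d) n * n + kof (c + d) n = kof (c + d) n * (n + 1) := by ring
  have h3 : kof (c + d) n * (n + 1) ≤ ((2 * (c + d) + 1) * (n + 1) + 1) * (n + 1) := Nat.mul_le_mul_right _ hk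
  omega

/-- **The budget is polynomially bounded** (the guard `L (sel ℓ) = ℓ` keeps the selected level, the
output length of `g` and hence `D`'s coin count below polynomials in `ℓ`). [folklore] -/
theorem cl_le (hqD : ∀ ℓ, D.coinLen ℓ ≤ qD.eval ℓ) (G : ℕ → Prop) :
    ∃ p : Polynomial ℕ, ∀ ℓ, cl D qD d c ℓg G ℓ ≤ p.eval ℓ := by
  set Q : Polynomial ℕ := Polynomial.X + Polynomial.C d * Polynomial.X * (Polynomial.X + 1) with hQ
  refine ⟨(qD.comp Q + 1) * basePoly d c + qD.comp Q, fun ℓ => ?_⟩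
  unfold cl
  split_ifs with h
  · set n := Yao.sel G (L ℓg) ℓ with hn
    have hnℓ : n ≤ ℓ := (le_L (ℓg := ℓg) n).trans h.le
    have h1 : Kof d n ≤ d * ℓ := (Nat.mul_le_mul_left d (Nat.log_le_self 2 n)).trans (Nat.mul_le_mul_left d hnℓ)
    have h2 : Kof d n * n + Kof d n ≤ d * ℓ * (ℓ + 1) :=
      calc Kof d n * n + Kof d n = Kof d n * (n + 1) := by ring
        _ ≤ d * ℓ * (ℓ + 1) := Nat.mul_le_mul h1 (by omega)
    have hLin : Lin d n (ℓg n) ≤ ℓ + d * ℓ * (ℓ + 1) := by unfold Lin; unfold L at h; omega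
    have hQe : Q.eval ℓ = ℓ + d * ℓ * (ℓ + 1) := by simp [hQ]
    have hq : qD.eval (Lin d n (ℓg n)) ≤ qD.eval (Q.eval ℓ) := by rw [hQe]; exact TM2Iter.eval_mono qD hLin
    have hKb : Kb qD d n (ℓg n) ≤ qD.eval (Q.eval ℓ) + 1 := by unfold Kb; omega
    have hκ : κD D d ℓg n ≤ qD.eval (Q.eval ℓ) := (hqD _).trans hq
    have hb : base d c n ≤ (basePoly d c).eval ℓ := (base_le n).trans (TM2Iter.eval_mono _ hnℓ)
    rw [Ctot_eq]
    calc Kb qD d n (ℓg n) * base d c n + κD D d ℓg n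
        ≤ (qD.eval (Q.eval ℓ) + 1) * (basePoly d c).eval ℓ + qD.eval (Q.eval ℓ) := add_le_add (Nat.mul_le_mul hKb hb) hκ
      _ = _ := by simp [Polynomial.eval_comp]
  · exact Nat.zero_le _

end Budget

/-! ### Arithmetic of the parameters -/

/-- **Enough seeds**: with `e = c + d`, `n ≤ 2(δ/2^{K+1})²(2^k − 1)` for `δ = 1/n^c` (`n ≥ 1`).
[folklore] -/
theorem n_le {n : ℕ} (hn : 1 ≤ n) (c d : ℕ) :
    (n : ℝ) ≤ 2 * (1 / (n : ℝ) ^ c / 2 ^ Kof d n / 2) ^ 2 * (2 ^ kof (c + d) n - 1 : ℕ) := by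
  have hK : 2 ^ Kof d n ≤ n ^ d := two_pow_Kof_le hn d
  have h4K : (2 ^ Kof d n) ^ 2 ≤ n ^ (2 * d) :=
    calc (2 ^ Kof d n) ^ 2 ≤ (n ^ d) ^ 2 := Nat.pow_le_pow_left hK 2
      _ = n ^ (2 * d) := by rw [← pow_mul, mul_comm]
  have hk := two_mul_pow_le_two_pow_kof (c + d) n
  have hnat : n * (2 * n ^ (2 * c) * (2 ^ Kof d n) ^ 2) ≤ 2 ^ kof (c + d) n - 1 :=
    calc n * (2 * n ^ (2 * c) * (2 ^ Kof d n) ^ 2) ≤ n * (2 * n ^ (2 * c) * n ^ (2 * d)) :=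
          Nat.mul_le_mul_left _ (Nat.mul_le_mul_left _ h4K)
      _ = 2 * n ^ (2 * (c + d) + 1) := by ring
      _ ≤ _ := hk
  have hnR : (0 : ℝ) < n := by exact_mod_cast hn
  have hR : 2 * (1 / (n : ℝ) ^ c / 2 ^ Kof d n / 2) ^ 2 * ((2 ^ kof (c + d) n - 1 : ℕ) : ℝ) =
      ((2 ^ kof (c + d) n - 1 : ℕ) : ℝ) / (2 * (n : ℝ) ^ (2 * c) * ((2 : ℝ) ^ Kof d n) ^ 2) := by
    field_simp
    ring
  rw [hR, le_div_iff₀ (by positivity)]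
  exact_mod_cast hnat

/-- The clean polynomial form of the success bound: `1/(2^{2e+4} n^{c+d+2e+1}) ≤ δ/(4·2^K·2^k)` for
`δ = 1/n^c`, `e = c + d`, `n ≥ 1`. [folklore] -/
theorem inv_poly_le {n : ℕ} (hn : 1 ≤ n) (c d : ℕ) :
    1 / (2 ^ (2 * (c + d) + 4) * (n : ℝ) ^ (c + d + (2 * (c + d) + 1))) ≤
      1 / (n : ℝ) ^ c / (4 * 2 ^ Kof d n * 2 ^ kof (c + d) n) := by
  have hnR : (0 : ℝ) < n := by exact_mod_cast hn
  have hK' : (2 : ℝ) ^ Kof d n ≤ (n : ℝ) ^ d := by exact_mod_cast two_pow_Kof_le hn d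
  have hk' : (2 : ℝ) ^ kof (c + d) n ≤ 2 ^ (2 * (c + d) + 2) * (n : ℝ) ^ (2 * (c + d) + 1) := by
    exact_mod_cast two_pow_kof_le hn (c + d)
  rw [div_div]
  apply one_div_le_one_div_of_le (by positivity)
  rw [show (n : ℝ) ^ (c + d + (2 * (c + d) + 1)) = (n : ℝ) ^ c * ((n : ℝ) ^ d * (n : ℝ) ^ (2 * (c + d) + 1)) by
      rw [pow_add, pow_add]; ring,
    show (2 : ℝ) ^ (2 * (c + d) + 4) = 4 * 2 ^ (2 * (c + d) + 2) by ring]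
  have h2 : (0 : ℝ) ≤ (2 : ℝ) ^ kof (c + d) n := by positivity
  have h3 : (2 : ℝ) ^ Kof d n * 2 ^ kof (c + d) n ≤ (n : ℝ) ^ d * (2 ^ (2 * (c + d) + 2) * (n : ℝ) ^ (2 * (c + d) + 1)) :=
    mul_le_mul hK' hk' h2 (by positivity)
  calc (n : ℝ) ^ c * (4 * 2 ^ Kof d n * 2 ^ kof (c + d) n) = 4 * (n : ℝ) ^ c * (2 ^ Kof d n * 2 ^ kof (c + d) n) := by ring
    _ ≤ 4 * (n : ℝ) ^ c * ((n : ℝ) ^ d * (2 ^ (2 * (c + d) + 2) * (n : ℝ) ^ (2 * (c + d) + 1))) :=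
        mul_le_mul_of_nonneg_left h3 (by positivity)
    _ = _ := by ring

/-- A nonnegative sequence that is not negligible is `≥ 1/n^c` infinitely often.
[Goldreich 2001, Def. 1.3.5] [folklore] -/
theorem exists_frequently_ge {u : ℕ → ℝ} (h0 : ∀ n, 0 ≤ u n)
    (h : ¬ SuperpolynomialDecay atTop (fun n : ℕ => (n : ℝ)) u) :
    ∃ c : ℕ, ∃ᶠ n : ℕ in atTop, 1 / (n : ℝ) ^ c ≤ u n := by
  have h' := (isNegligible_iff_eventually_lt_of_nonneg h0).not.1 h
  push Not at h'
  obtain ⟨c, hc⟩ := h'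
  exact ⟨c, by simpa [Filter.not_eventually, not_lt] using hc⟩

/-! ### The theorem -/

/-- **The Goldreich–Levin theorem for hiding functions (fixed output length) from the efficiency of
`𝒜_GL`.** If the run function of the Goldreich–Levin inverter is polynomial time
(`GLInv.glInvRun_polyTime`), then `goldreichLevin_hiding_len` holds: for an `𝒮`-hiding `g` of fixed
output length on the seeds (levels eventually nonempty), `{g(x‖ρ) ‖ σ ‖ GL(x, σ)}` and
`{g(x‖ρ) ‖ σ ‖ U}` are computationally indistinguishable. Proof: if a PPT `D` has advantage `≥ 1/n^c`
infinitely often, run `𝒜_GL` (`e = c + d` seeds parameter, `D`'s coin polynomial `q_D`) with the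
budget `cl` on the sparse sequence of good levels `Yao.seqN`; it is PPT (`cl_le`) and recovers
`x ← S_n` with probability `≥ 1/(2^{2e+4} n^{c+d+2e+1})` at every selected level
(`GLInv.hidingProb_ge` with `Ctot_mod`, `cl_apply_L`, `n_le`, `inv_poly_le`) — infinitely often,
whereas hiding makes this probability negligible. [O. Goldreich, L. Levin, STOC 1989; Goldreich
2001, Thm 2.5.6 with §2.5.2; Y. Liu, R. Pass, FOCS 2020, Appendix, Thm [GL89]]
[cite: LiuPassFOCS2020, Appendix (Thm [GL89], hardcore functions for S-hiding f)] -/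
theorem goldreichLevin_hiding_len_of_polyTime (hrun : glInvRun_polyTime) : goldreichLevin_hiding_len := by
  intro S g m d ℓg hlen hne hhid D hD
  by_contra hneg
  obtain ⟨c, hc⟩ := exists_frequently_ge (fun n => distAdvantage_nonneg D _ _ n) hneg
  obtain ⟨qD, hqD⟩ := hD.2
  -- the good levels: large advantage, nonempty `S_n`, `n ≥ 1`
  set G : ℕ → Prop := fun n =>
    1 / (n : ℝ) ^ c ≤ distAdvantage D (glRealEns g S m d) (glIdealEns g S m d) n ∧ (S n).Nonempty ∧ 1 ≤ n with hGdef
  have hGfreq : ∃ᶠ n in atTop, G n := hc.and_eventually (hne.and (eventually_ge_atTop 1))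
  have hG : ∀ a, ∃ b, a ≤ b ∧ G b := fun a => by
    obtain ⟨b, hb, hGb⟩ := Filter.frequently_atTop.1 hGfreq a
    exact ⟨b, hb, hGb⟩
  -- the inverter and its efficiency
  set A : RandAlg (List Bool) (List Bool) := alg D qD d (c + d) (cl D qD d c ℓg G) with hA
  have hAppt : IsPPT A id := ⟨hrun D qD d (c + d) hD, cl_le (ℓg := ℓg) hqD G⟩
  have hdecay := hhid A hAppt
  -- the lower bound along the selected levels
  have hlow : ∀ j, 1 / (2 ^ (2 * (c + d) + 4) * ((Yao.seqN G (L ℓg) j : ℕ) : ℝ) ^ (c + d + (2 * (c + d) + 1))) ≤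
      hidingProb g A S m (Yao.seqN G (L ℓg) j) := by
    intro j
    set n := Yao.seqN G (L ℓg) j with hndef
    obtain ⟨hadv, hS, hn⟩ := Yao.seqN_good (w := L ℓg) hG j
    have hnR : (0 : ℝ) < n := by exact_mod_cast hn
    refine (inv_poly_le hn c d).trans ?_
    have h := GLInv.hidingProb_ge D qD d (c + d) g S m (n := n) (ℓ := ℓg n) (κ := κD D d ℓg n) (W := W qD d c ℓg n)
      (cl D qD d c ℓg G) (δ := 1 / (n : ℝ) ^ c) hS (fun x hx ρ => hlen n x ρ.toList hx ρ.toList_length) rfl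
      (Ctot_mod D qD d c ℓg hqD n) (cl_apply_L hG j) (Nat.succ_pos _) (by positivity) hadv (n_le hn c d)
    rw [div_div] at h ⊢
    simpa [mul_comm, mul_assoc, mul_left_comm] using h
  have hfreq : ∃ᶠ n : ℕ in atTop, 1 / (2 ^ (2 * (c + d) + 4) * (n : ℝ) ^ (c + d + (2 * (c + d) + 1))) ≤ hidingProb g A S m n := by
    refine Filter.frequently_atTop.2 fun N => ⟨Yao.seqN G (L ℓg) N, ?_, hlow N⟩
    exact (Yao.seqN_strictMono hG le_L).id_le N
  -- negligibility says the opposite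
  set a := c + d + (2 * (c + d) + 1) with ha
  have hev : ∀ᶠ n : ℕ in atTop, hidingProb g A S m n < 1 / (n : ℝ) ^ (a + 1) :=
    (isNegligible_iff_eventually_lt_of_nonneg (fun n => hidingProb_nonneg g A S m n)).1 hdecay (a + 1)
  have hev4 : ∀ᶠ n : ℕ in atTop, 1 / (n : ℝ) ^ (a + 1) ≤ 1 / (2 ^ (2 * (c + d) + 4) * (n : ℝ) ^ a) := by
    filter_upwards [eventually_ge_atTop (2 ^ (2 * (c + d) + 4))] with n hn
    have hnR : (2 : ℝ) ^ (2 * (c + d) + 4) ≤ n := by exact_mod_cast hn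
    have hn0 : (0 : ℝ) < n := lt_of_lt_of_le (by positivity) hnR
    apply one_div_le_one_div_of_le (by positivity)
    rw [pow_succ (n : ℝ) a, mul_comm ((n : ℝ) ^ a)]
    exact mul_le_mul_of_nonneg_right hnR (by positivity)
  obtain ⟨n, h1, h2, h3⟩ := (hfreq.and_eventually (hev.and hev4)).exists
  linarith

end GLFin

end Literature.Computability.Cryptography
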